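/- Copyright: the b2b-balaban cell (near-miss cell 7), T⁴-continuum fan-out; row NE7b CRUX team (2), seat
t4-ne7b-formalise-leaf-05 (gen 34) — IR-46-2's standing division «… leaf-05 toy-instantiates» applied to the custodian
leaf-03 g28's IR-51-2 «THE WEIGHTED PLUG CHAIN» record (W3 `HistoryRealiseCellsRunAssemblyWTVSDataLP`, W4
`…AssemblyWTVSLP`, W5 `…AssemblyWTVSLWP82` = the D-50-2 deliverable; OWNER g51 W-ne7bp1-g51-5), part 13 of the sanity series.  Released under the licence of the surrounding
project. -/
import Summits.QuantumFields.BalabanUV.T4Continuum.Support.HistoryRealiseCellsRunAssemblyWTVSSanityL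
import Summits.QuantumFields.BalabanUV.T4Continuum.Support.HistoryRealiseCellsRunAssemblyWTVSSanityLWD
import Summits.QuantumFields.BalabanUV.T4Continuum.Support.HistoryRealiseCellsRunAssemblyWTVSLP
import Summits.QuantumFields.BalabanUV.T4Continuum.Support.HistoryRealiseCellsRunAssemblyWTVSLWP82
import Summits.QuantumFields.BalabanUV.T4Continuum.Support.HistoryRealiseCellsRunAssemblyWTVSLWKP82
import Summits.QuantumFields.BalabanUV.T4Continuum.Support.HistoryRealiseCellsRunAssemblyWTVSSanityLWKToy

/-!
# Sanity for the (α) assembly, part 13: THE PLUG RECORD `HistReadDataLP` (IR-51-2 W3) HAS A KERNEL INHABITANT ON THE CELL's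
TOY DATUM — THREE ROADS (FLAT, PREFIX, AND M5-2e's PER-LEVEL DEAD BOX), NO DATUM HYPOTHESIS — AND W4∕W5's WITNESSES RUN ON IT
(companion of `HistoryRealiseCellsRunAssemblyWTVSDataLP` ∕ `…AssemblyWTVSLP` ∕ `…AssemblyWTVSLWP82`; lineage `t4-ne7b-formalise-leaf-05` gen 34)

Summits-side support leaf of the T⁴-continuum cell (rung (B)+1 on a FINITE torus only; NOT infinite volume, NOT the
mass gap, NOT Clay; NOT a proof of NE7b — NOT PRINTED, NOT PROVED).  [decided toy] one-liners over part 4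
(`nonempty_histReadDataL_toyData`), part 7 (`nonempty_histReadDataL_toyData_viaLW`, `exists_pow_windows`) and the
custodian's W4 (`HistReadDataL.toLP`, `nonempty_countRoadWitnessT3bWTVSL_of_histReadingLP`) and W5 (`HistReadDataLW.toLP82`,
`nonempty_countRoadWitnessT3bWTVSL_of_histReadingLW82`), REUSED BY NAME; no `def`,
nothing printed asserted, no `def … : Prop` fact, no cite-tagged hypothesis, zero `sorry`.

§17 **`nonempty_histReadDataLP_toyData`**: `HistReadDataLP (toyData F G) C₂ O₁ θᵥ 1 1 n hn gE [] Isk Isk …` INHABITED — part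
4's guarded L record through W4's flat embedding `toLP` (`wV := 2^{d+3}`, `hplug := plug_of_histReadingL`); every `θᵥ`,
`n > 0`.  **`nonempty_histReadDataLP_toyData_viaLW`** ∕ **`exists_histReadDataLP_toyData_viaLW`**: the same at part 7's
letters (`C₃`, window couplings `gW F.L S ≡ e^{−L^S∕2}`, any `0 < θᵥ`, `0 ≤ cΛ Lr Φ β₀`) THROUGH THE PREFIX ROAD `toL` beyond
the two windows, then `toLP`; unconditionally for SOME window run.  W4 §1 (`nonempty_countRoadWitnessT3bWTVSL_of_histReadingLP`)
RUN BY NAME on both, as `example`s (the guarded witness's statement coincides with part 4's `…_toyData_guarded` ∕ part 7's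
`…_toyData_viaLW`, reserved by the gate's dedup rule).  On the toy reading the plug `hplug` quantifies over NO live
component and `huV` over NO bad term — both VACUOUS by design; `hwV` is `le_rfl` at the flat weight: the LP record's
non-vacuity certificate, NOT a headline instance.
§18 **THE M5-2e ROAD (D-50-2) ON THE TOY**: part 7's LW inhabitant through the custodian's `HistReadDataLW.toLP82` beyond the
rounding window `ℓ⋆` and the PER-LEVEL DEAD-BOX volume window `ellVolS82 C₃ 1 1 3 cΛ θᵥ (1+β₀) (jvol82 1 (1+β₀))` —
**`nonempty_histReadDataLP_toyData_viaLW82`** (the plug record AT WEIGHT `cvol82`, every `S` past both windows),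
**`exists_histReadDataLP_toyData_viaLW82`** (for SOME window run an inhabitant WHOSE WEIGHT IS `cvol82 1 (jvol82 1 (1+β₀)) (1+β₀)`,
by `rfl` on `toLP82`), **`nonempty_countRoadWitnessT3bWTVSL_toyData_viaLW82`** (W5 §2 BY NAME; its window hypothesis is the
S82 one, so the statement is new; W5 = v3 p300797, the window-blind `_fsc82` terminal twin dropped per E-ne7bleaf03g28-1).  The windows are paid by SMALLNESS OF g (`gW ≡ e^{−L^S∕2}`), never by the record.  W6
(`…AssemblyWTVSLWKP82`, p-landed with W5 v3): its two witnesses `…_of_histReadingLWD82` ∕ `…_of_histReadingLWK82` RUN BY NAME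
on part 9's decorated toy and part 11's key-side toy, as `example`s (statement = `…_toyData_viaLW82`'s).

HONEST.  «inhabitable» = «no field unsatisfiable as typed, jointly» at toy letters (c2) with `liveCV = ∅`; nothing about
Bałaban's volume plug on a real reading; (B) FAILS on `toyData` (W4 §3 has no instance there); BY-NAME EFFECT ON THE WALL:
NONE; NE7b NOT proved; spine 0∕9.  HONEST DEPENDENCY (cell): continuum YM on T⁴ ⇐ BetaPertH ∧ nine spine estimates (0/9
proved); BetaPertH ⇐ (D1) ∧ (D4) ∧ CAP+tail; G-an2-4 gates asym, D1 and NE2/3/4.  Unchanged here.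
-/

open Finset MeasureTheory
open Literature.MathematicalPhysics.QuantumFieldTheory.Balaban1983to89
open T4PersistenceDictionary T4PersistentHistoryCount T4BankedInduction T4PrintedShapeBanking
open T4WeightBudget T4GlobalDenominator T4LiveClassFibration T4LiveStructureGas T4LiveGasToTerms T4RecordPriceSeam
open T4PartnerMultiplicity T4IndicatorShell T4MatchingAssembly T4MatchingClosure T4MatchingClosureSocket T4Continuum
open T4StabilitySocket T4BranchingRecordsGas T4TaggedShapeBanking T4CanonicalMenus T4RenewalChains
open Summit.QuantumFields.BalabanUV.T4Continuum.HistoryFlow Summit.QuantumFields.BalabanUV.T4Continuum.HistoryGen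
open Summit.QuantumFields.BalabanUV.T4Continuum.HistoryGenealogyRealise
open Summit.QuantumFields.BalabanUV.T4Continuum.HistoryGenealogyInstantiate
open Summit.QuantumFields.BalabanUV.T4Continuum.HistoryAssemblyTerms
open Summit.QuantumFields.BalabanUV.T4Continuum.HistoryAssemblyMult Summit.QuantumFields.BalabanUV.T4Continuum.HistoryAssemblyMultKey
open Summit.QuantumFields.BalabanUV.T4Continuum.HistorySocketTH
open Summit.QuantumFields.BalabanUV.T4Continuum.HistoryRealiseCellsRunApexT3bWTVS
open Summit.QuantumFields.BalabanUV.T4Continuum.HistoryRealiseCellsRunApexT3bWTVSL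
open Summit.QuantumFields.BalabanUV.T4Continuum.B16HistoryIndexedRepr
open Summit.QuantumFields.BalabanUV.T4Continuum.B16HistoryIndexedTrunc
open Summit.QuantumFields.BalabanUV.T4Continuum.HistoryConstants Summit.QuantumFields.BalabanUV.T4Continuum.HistoryBankingDiscountCharge
open Summit.QuantumFields.BalabanUV.T4Continuum.HistoryBankingCreditRead
open Summit.QuantumFields.BalabanUV.T4Continuum.HistoryBankingFibreRoom
open Summit.QuantumFields.BalabanUV.T4Continuum.HistoryPriceNodeSum Summit.QuantumFields.BalabanUV.T4Continuum.HistoryPriceKeys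
open Summit.QuantumFields.BalabanUV.T4Continuum.HistoryRealiseCellsRunSupplyWTVS
open Summit.QuantumFields.BalabanUV.T4Continuum.HistoryRealiseCellsRunSupplyKeysWTVS
open Summit.QuantumFields.BalabanUV.T4Continuum.HistoryRealiseCellsRunSupplyWTVSSanity
open Summit.QuantumFields.BalabanUV.T4Continuum.HistoryRealiseCellsRunAssemblyWTVSData
open Summit.QuantumFields.BalabanUV.T4Continuum.HistoryRealiseCellsRunAssemblyWTVSDataL
open Summit.QuantumFields.BalabanUV.T4Continuum.HistoryRealiseCellsRunAssemblyWTVSDataLW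
open Summit.QuantumFields.BalabanUV.T4Continuum.HistoryRealiseCellsRunAssemblyWTVSDataLWD
open Summit.QuantumFields.BalabanUV.T4Continuum.HistoryRealiseCellsRunAssemblyWTVSLW
open Summit.QuantumFields.BalabanUV.T4Continuum.HistoryRealiseCellsRunAssemblyWTVSLWD
open Summit.QuantumFields.BalabanUV.T4Continuum.HistoryRealiseCellsRunAssemblyWTVSDataLP
open Summit.QuantumFields.BalabanUV.T4Continuum.HistoryRealiseCellsRunAssemblyWTVSLP
open Summit.QuantumFields.BalabanUV.T4Continuum.HistoryRealiseCellsRunAssemblyWTVSLWP82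
open Summit.QuantumFields.BalabanUV.T4Continuum.HistoryRealiseCellsRunAssemblyWTVSLWKP82
open Summit.QuantumFields.BalabanUV.T4Continuum.HistoryRealiseCellsRunAssemblyWTVSDataLWK
open Summit.QuantumFields.BalabanUV.T4Continuum.HistoryBankingVolumeWindowShrunk82 (jvol82 ellVolS82)
open Summit.QuantumFields.BalabanUV.T4Continuum.HistoryBankingShrunkLedger82 (cvol82)
open Summit.QuantumFields.BalabanUV.T4Continuum.HistoryRealiseCellsRunSupplyFibreWTVS
open Summit.QuantumFields.BalabanUV.T4Continuum.HistoryRealiseCellsRunApexWitness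
open Summit.QuantumFields.BalabanUV.T4Continuum.HistoryBankingSharpShares (ell sBsharp)
open Summit.QuantumFields.BalabanUV.T4Continuum.HistoryBankingRoundingUnrounded (sRunr ApFlat)
open Summit.QuantumFields.BalabanUV.T4Continuum.HistoryBankingRoundingSupply (ellStar)
open Summit.QuantumFields.BalabanUV.T4Continuum.HistoryBankingVolumeWindow (uvol lamVol jvol)
open Summit.QuantumFields.BalabanUV.T4Continuum.HistoryBankingVolumeSupply (ellVol)
open Missing AveragingRT

namespace Summit.QuantumFields.BalabanUV.T4Continuum.HistoryRealiseCellsRunAssemblyWTVSSanity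

noncomputable section

open B16HistoryIndexedRepr.Sanity B16HistoryIndexedRepr.SanityInput HistoryConstants.Sanity

set_option synthInstance.maxSize 1024

/-! ## §17 The plug record on the toy datum: the flat road and the prefix road -/

section ToyData

variable (F : T4Family) (G : Type) [GaugeGroup G] [MeasurableSpace G] [HaarData G] [RegularGaugeGroup G]

/-- **`HistReadDataLP` IS INHABITED — NO DATUM HYPOTHESIS** — on the toy datum at part 4's letters: the guarded L record
through W4's flat embedding `HistReadDataL.toLP` (`wV := 2^{d+3}`, the plug from M5-2c's displays by `plug_of_histReadingL`;
on the toy the plug and `huV` are VACUOUS — no live component, no bad term). [decided toy] -/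
theorem nonempty_histReadDataLP_toyData (θv : ℝ) (n : ℕ) (hn : 0 < n) :
    Nonempty (HistReadDataLP (toyData F G) C₂ O₁ θv 1 1 n hn gE ([] : List (ULoop F)) Isk Isk (fun _ => Unit) μ₀
      (fun _ => GoodClass.top Unit) (fun _ => Unit) μ₀ (fun _ => GoodClass.top Unit)) :=
  (nonempty_histReadDataL_toyData F G θv n hn).map fun X => X.toLP

/-- **W4 §1 RUN BY NAME ON IT**: the guarded witness through the plug road — an `example` (statement = part 4's
`nonempty_countRoadWitnessT3bWTVSL_toyData_guarded`, reserved by the dedup rule). [decided toy] -/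
example (θv : ℝ) (n : ℕ) (hn : 0 < n) :
    Nonempty (CountRoadWitnessT3bWTVSL (toyData F G) C₂ O₁ θv 1 1 n hn gE ([] : List (ULoop F)) (HIndex.Idx Isk)
      (ℕ × Lab 1) (Lab 1)) :=
  (nonempty_histReadDataLP_toyData F G θv n hn).elim fun Dd => nonempty_countRoadWitnessT3bWTVSL_of_histReadingLP Dd

/-- **THE PLUG RECORD THROUGH THE PREFIX ROAD**: part 7's LW inhabitant at the window couplings, the custodian's `toL` beyond
the rounding window `ℓ⋆` and the volume window `ℓ⋆ᵥ`, then W4's `toLP` — `HistReadDataLP (toyData F G) C₃ O₁ θᵥ 1 1 n hn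
(gW F.L S) [] …` inhabited for every `1 ≤ S` past both windows, `0 < θᵥ`, `0 ≤ cΛ Lr Φ β₀`. [decided toy] -/
theorem nonempty_histReadDataLP_toyData_viaLW {S : ℕ} (hS : 1 ≤ S) {θv : ℝ} (hθv : 0 < θv) {cΛ Lr Φ : ℝ} (hcΛ : 0 ≤ cΛ)
    (hLr : 0 ≤ Lr) (hΦ : 0 ≤ Φ) {β₀ : ℝ} (hβ₀ : 0 ≤ β₀) (n : ℕ) (hn : 0 < n)
    (hr : ellStar C₃ O₁ F.L (O₁.d + 3) 2 1 1 (ApFlat O₁.γ₀ O₁.A₁ O₁.M Lr O₁.d) Φ ≤ (F.L : ℝ) ^ S)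
    (hv : ellVol C₃ 1 1 3 cΛ θv (1 + β₀) (jvol 1 (1 + β₀)) ≤ (F.L : ℝ) ^ S) :
    Nonempty (HistReadDataLP (toyData F G) C₃ O₁ θv 1 1 n hn (gW F.L S) ([] : List (ULoop F)) Isk Isk (fun _ => Unit) μ₀
      (fun _ => GoodClass.top Unit) (fun _ => Unit) μ₀ (fun _ => GoodClass.top Unit)) :=
  (nonempty_histReadDataL_toyData_viaLW F G hS hθv hcΛ hLr hΦ hβ₀ n hn hr hv).map fun X => X.toLP

/-- **… UNCONDITIONALLY for SOME window run** (`exists_pow_windows`). [decided toy] -/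
theorem exists_histReadDataLP_toyData_viaLW {θv : ℝ} (hθv : 0 < θv) {cΛ Lr Φ : ℝ} (hcΛ : 0 ≤ cΛ) (hLr : 0 ≤ Lr)
    (hΦ : 0 ≤ Φ) {β₀ : ℝ} (hβ₀ : 0 ≤ β₀) (n : ℕ) (hn : 0 < n) :
    ∃ S : ℕ, Nonempty (HistReadDataLP (toyData F G) C₃ O₁ θv 1 1 n hn (gW F.L S) ([] : List (ULoop F)) Isk Isk
      (fun _ => Unit) μ₀ (fun _ => GoodClass.top Unit) (fun _ => Unit) μ₀ (fun _ => GoodClass.top Unit)) := by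
  obtain ⟨S, hS, hr, hv⟩ := exists_pow_windows F
    (ellStar C₃ O₁ F.L (O₁.d + 3) 2 1 1 (ApFlat O₁.γ₀ O₁.A₁ O₁.M Lr O₁.d) Φ) (ellVol C₃ 1 1 3 cΛ θv (1 + β₀) (jvol 1 (1 + β₀)))
  exact ⟨S, nonempty_histReadDataLP_toyData_viaLW F G hS hθv hcΛ hLr hΦ hβ₀ n hn hr hv⟩

/-- **W4 §1 ON THE PREFIX ROAD's PLUG RECORD** beyond the two windows — an `example` (statement = part 7's
`nonempty_countRoadWitnessT3bWTVSL_toyData_viaLW`). [decided toy] -/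
example {S : ℕ} (hS : 1 ≤ S) {θv : ℝ} (hθv : 0 < θv) {cΛ Lr Φ : ℝ} (hcΛ : 0 ≤ cΛ) (hLr : 0 ≤ Lr) (hΦ : 0 ≤ Φ) {β₀ : ℝ}
    (hβ₀ : 0 ≤ β₀) (n : ℕ) (hn : 0 < n)
    (hr : ellStar C₃ O₁ F.L (O₁.d + 3) 2 1 1 (ApFlat O₁.γ₀ O₁.A₁ O₁.M Lr O₁.d) Φ ≤ (F.L : ℝ) ^ S)
    (hv : ellVol C₃ 1 1 3 cΛ θv (1 + β₀) (jvol 1 (1 + β₀)) ≤ (F.L : ℝ) ^ S) :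
    Nonempty (CountRoadWitnessT3bWTVSL (toyData F G) C₃ O₁ θv 1 1 n hn (gW F.L S) ([] : List (ULoop F)) (HIndex.Idx Isk)
      (ℕ × Lab 1) (Lab 1)) :=
  (nonempty_histReadDataLP_toyData_viaLW F G hS hθv hcΛ hLr hΦ hβ₀ n hn hr hv).elim fun Dd =>
    nonempty_countRoadWitnessT3bWTVSL_of_histReadingLP Dd

/-! ## §18 The M5-2e road (D-50-2) on the toy: the plug record at weight `cvol82` beyond the windows `ℓ⋆`, `ℓᵥ82` -/

/-- **THE PLUG RECORD AT M5-2e's WEIGHT ON THE TOY** (D-50-2's road): part 7's LW inhabitant through the custodian's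
`HistReadDataLW.toLP82` for `S` beyond the rounding window `ℓ⋆` and the per-level dead-box window `ℓᵥ82`. [decided toy] -/
theorem nonempty_histReadDataLP_toyData_viaLW82 {S : ℕ} (hS : 1 ≤ S) {θv : ℝ} (hθv : 0 < θv) {cΛ Lr Φ : ℝ} (hcΛ : 0 ≤ cΛ)
    (hLr : 0 ≤ Lr) (hΦ : 0 ≤ Φ) {β₀ : ℝ} (hβ₀ : 0 ≤ β₀) (n : ℕ) (hn : 0 < n)
    (hr : ellStar C₃ O₁ F.L (O₁.d + 3) 2 1 1 (ApFlat O₁.γ₀ O₁.A₁ O₁.M Lr O₁.d) Φ ≤ (F.L : ℝ) ^ S)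
    (hv : ellVolS82 C₃ 1 1 3 cΛ θv (1 + β₀) (jvol82 1 (1 + β₀)) ≤ (F.L : ℝ) ^ S) :
    Nonempty (HistReadDataLP (toyData F G) C₃ O₁ θv 1 1 n hn (gW F.L S) ([] : List (ULoop F)) Isk Isk (fun _ => Unit) μ₀
      (fun _ => GoodClass.top Unit) (fun _ => Unit) μ₀ (fun _ => GoodClass.top Unit)) :=
  ⟨(histReadDataLW_toyData F G hS hθv hcΛ hLr hΦ hβ₀ n hn).toLP82 (inInterval_toyData_gW F G hr)
    (inInterval_toyData_gW F G hv)⟩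

/-- **… for SOME window run, an inhabitant WHOSE WEIGHT IS M5-2e's `cvol82`** (`exists_pow_windows`; the weight by `rfl` on
`toLP82`). [decided toy] -/
theorem exists_histReadDataLP_toyData_viaLW82 {θv : ℝ} (hθv : 0 < θv) {cΛ Lr Φ : ℝ} (hcΛ : 0 ≤ cΛ) (hLr : 0 ≤ Lr)
    (hΦ : 0 ≤ Φ) {β₀ : ℝ} (hβ₀ : 0 ≤ β₀) (n : ℕ) (hn : 0 < n) :
    ∃ S : ℕ, ∃ Dd : HistReadDataLP (toyData F G) C₃ O₁ θv 1 1 n hn (gW F.L S) ([] : List (ULoop F)) Isk Isk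
      (fun _ => Unit) μ₀ (fun _ => GoodClass.top Unit) (fun _ => Unit) μ₀ (fun _ => GoodClass.top Unit),
      Dd.wV = fun _ => cvol82 1 (jvol82 1 (1 + β₀)) (1 + β₀) := by
  obtain ⟨S, hS, hr, hv⟩ := exists_pow_windows F
    (ellStar C₃ O₁ F.L (O₁.d + 3) 2 1 1 (ApFlat O₁.γ₀ O₁.A₁ O₁.M Lr O₁.d) Φ)
    (ellVolS82 C₃ 1 1 3 cΛ θv (1 + β₀) (jvol82 1 (1 + β₀)))
  exact ⟨S, (histReadDataLW_toyData F G hS hθv hcΛ hLr hΦ hβ₀ n hn).toLP82 (inInterval_toyData_gW F G hr)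
    (inInterval_toyData_gW F G hv), rfl⟩

/-- **W5 §2 RUN BY NAME ON THE TOY**: the guarded witness through the M5-2e road beyond `ℓ⋆` and `ℓᵥ82`. [decided toy] -/
theorem nonempty_countRoadWitnessT3bWTVSL_toyData_viaLW82 {S : ℕ} (hS : 1 ≤ S) {θv : ℝ} (hθv : 0 < θv) {cΛ Lr Φ : ℝ}
    (hcΛ : 0 ≤ cΛ) (hLr : 0 ≤ Lr) (hΦ : 0 ≤ Φ) {β₀ : ℝ} (hβ₀ : 0 ≤ β₀) (n : ℕ) (hn : 0 < n)
    (hr : ellStar C₃ O₁ F.L (O₁.d + 3) 2 1 1 (ApFlat O₁.γ₀ O₁.A₁ O₁.M Lr O₁.d) Φ ≤ (F.L : ℝ) ^ S)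
    (hv : ellVolS82 C₃ 1 1 3 cΛ θv (1 + β₀) (jvol82 1 (1 + β₀)) ≤ (F.L : ℝ) ^ S) :
    Nonempty (CountRoadWitnessT3bWTVSL (toyData F G) C₃ O₁ θv 1 1 n hn (gW F.L S) ([] : List (ULoop F)) (HIndex.Idx Isk)
      (ℕ × Lab 1) (Lab 1)) :=
  nonempty_countRoadWitnessT3bWTVSL_of_histReadingLW82 (histReadDataLW_toyData F G hS hθv hcΛ hLr hΦ hβ₀ n hn)
    (inInterval_toyData_gW F G hr) (inInterval_toyData_gW F G hv)

/-- **W6's TWO WITNESSES RUN BY NAME ON THE DECORATED AND THE KEY-SIDE TOYS** (parts 9 ∕ 11) beyond `ℓ⋆` and `ℓᵥ82` — the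
chains `toLW ∘ toLP82` and `toLWD ∘ toLW ∘ toLP82` compose on inhabitants; `example`s (statement = `…_toyData_viaLW82`'s).
[decided toy] -/
example {S : ℕ} (hS : 1 ≤ S) {θv : ℝ} (hθv : 0 < θv) {cΛ Lr Φ : ℝ} (hcΛ : 0 ≤ cΛ) (hLr : 0 ≤ Lr) (hΦ : 0 ≤ Φ) {β₀ : ℝ}
    (hβ₀ : 0 ≤ β₀) (n : ℕ) (hn : 0 < n)
    (hr : ellStar C₃ O₁ F.L (O₁.d + 3) 2 1 1 (ApFlat O₁.γ₀ O₁.A₁ O₁.M Lr O₁.d) Φ ≤ (F.L : ℝ) ^ S)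
    (hv : ellVolS82 C₃ 1 1 3 cΛ θv (1 + β₀) (jvol82 1 (1 + β₀)) ≤ (F.L : ℝ) ^ S) :
    Nonempty (CountRoadWitnessT3bWTVSL (toyData F G) C₃ O₁ θv 1 1 n hn (gW F.L S) ([] : List (ULoop F)) (HIndex.Idx Isk)
      (ℕ × Lab 1) (Lab 1)) :=
  nonempty_countRoadWitnessT3bWTVSL_of_histReadingLWD82 (histReadDataLWD_toyData F G hS hθv hcΛ hLr hΦ hβ₀ n hn)
    (inInterval_toyData_gW F G hr) (inInterval_toyData_gW F G hv)

example {S : ℕ} (hS : 1 ≤ S) {θv : ℝ} (hθv : 0 < θv) {cΛ Lr Φ : ℝ} (hcΛ : 0 ≤ cΛ) (hLr : 0 ≤ Lr) (hΦ : 0 ≤ Φ) {β₀ : ℝ}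
    (hβ₀ : 0 ≤ β₀) (n : ℕ) (hn : 0 < n)
    (hr : ellStar C₃ O₁ F.L (O₁.d + 3) 2 1 1 (ApFlat O₁.γ₀ O₁.A₁ O₁.M Lr O₁.d) Φ ≤ (F.L : ℝ) ^ S)
    (hv : ellVolS82 C₃ 1 1 3 cΛ θv (1 + β₀) (jvol82 1 (1 + β₀)) ≤ (F.L : ℝ) ^ S) :
    Nonempty (CountRoadWitnessT3bWTVSL (toyData F G) C₃ O₁ θv 1 1 n hn (gW F.L S) ([] : List (ULoop F)) (HIndex.Idx Isk)
      (ℕ × Lab 1) (Lab 1)) :=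
  nonempty_countRoadWitnessT3bWTVSL_of_histReadingLWK82 (histReadDataLWK_toyData F G hS hθv hcΛ hLr hΦ hβ₀ n hn)
    (inInterval_toyData_gW F G hr) (inInterval_toyData_gW F G hv)

/-- HONESTY CERTIFICATE: (B) FAILS on the toy datum, so W4 §3's terminal theorem `continuumYM4Torus_of_histReadingLP_fsc`
(binder `hB`; W5 adds NO terminal theorem — the `_fsc` statements are window-blind, custodian ERRATUM E-ne7bleaf03g28-1) has no instance on it. [decided toy] -/
example : ¬ B16.EndStatementBPrinted (toyData F G).C := not_endStatementBPrinted_toy F G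

end ToyData

end

end Summit.QuantumFields.BalabanUV.T4Continuum.HistoryRealiseCellsRunAssemblyWTVSSanity
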